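import Literature.Dynamics.NBody.AlbouyKaloshin2012SliceBranchesPositive
import Literature.Dynamics.NBody.JensenLeykin2025Transfer

/-!
# From two `T12` branch systems to finitely many positive central configurations

End-to-end form of the branch reduction, stated on Definition 1 of [AlbouyKaloshin2012] (p. 536):
`t12PositiveCCs b c` is the set of POSITIVE NORMALIZED CENTRAL CONFIGURATIONS (`IsPositiveNormalizedCC`,
system (1), all `r_kl > 0`) of the masses `(1,1,b,b,c)` that are in the `T12` normal form — bodies 1, 2 at
`(∓s, t)`, bodies 3, 4, 5 on the `y`-axis (`t12Q`).  Chain of in-tree facts: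
positive CC ⟹ real normalized CC of system (4) with `δ_kl = r_kl⁻¹ > 0`
(`isRealNormalizedCC_of_isPositiveNormalizedCC`) ⟹ the twelve slice equations
(`isRealNormalizedCC_t12_iff`) with `u, d₃₄, d₃₅, d₄₅ > 0` ⟹ a point of `t12PosSet b c`, which is finite as
soon as the two branch systems `σ = (1,1,1,1)` and `(1,1,1,−1)` are (`t12PosSet_finite_of_two`).  Hence
`t12PositiveCCs_finite_of_two`.  The only new ingredient is the bookkeeping identity `deltaOfPos_t12Q`: the
matrix of inverse distances of a `T12`-shaped configuration has the mirror pattern `t12Delta`.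
No finiteness is asserted unconditionally; at `(b,c) = (1, 1/4)` the hypotheses are exactly what the cell's
mod-p Gröbner computations of the branches `++++` and `+++-` probe (`certs/modgb/README.md`).
-/

namespace Literature.Dynamics.NBody

/-- Positive normalized central configurations (Definition 1) of the masses `(1,1,b,b,c)` in the `T12`
normal form `t12Q s t y₃ y₄ y₅`. [cite: AlbouyKaloshin2012, Definition 1 p. 536] -/
def t12PositiveCCs (b c : ℝ) : Set (Fin 5 → ℝ × ℝ) :=
  {q | IsPositiveNormalizedCC (e32Masses b c) q ∧ ∃ s t y₃ y₄ y₅ : ℝ, q = t12Q s t y₃ y₄ y₅}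

/-- Inverse distances of pairwise distinct points are positive off the diagonal. [folklore] -/
theorem deltaOfPos_pos {n : ℕ} {q : Fin n → ℝ × ℝ} (hd : ∀ k l : Fin n, k ≠ l → q k ≠ q l)
    {k l : Fin n} (hkl : k ≠ l) : 0 < deltaOfPos q k l := by
  simp only [deltaOfPos, hkl, if_false]
  exact one_div_pos.mpr (Real.sqrt_pos.mpr (sqDist_pos_of_ne (hd k l hkl)))

/-- The inverse-distance matrix of a `T12`-shaped configuration has the mirror pattern `t12Delta`
(`δ₁ₖ = δ₂ₖ` for the axis bodies `k = 3,4,5`). [folklore] -/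
theorem deltaOfPos_t12Q (s t y₃ y₄ y₅ : ℝ) :
    deltaOfPos (t12Q s t y₃ y₄ y₅) =
      t12Delta (deltaOfPos (t12Q s t y₃ y₄ y₅) 0 1) (deltaOfPos (t12Q s t y₃ y₄ y₅) 0 2)
        (deltaOfPos (t12Q s t y₃ y₄ y₅) 0 3) (deltaOfPos (t12Q s t y₃ y₄ y₅) 0 4)
        (deltaOfPos (t12Q s t y₃ y₄ y₅) 2 3) (deltaOfPos (t12Q s t y₃ y₄ y₅) 2 4)
        (deltaOfPos (t12Q s t y₃ y₄ y₅) 3 4) := by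
  funext k l
  fin_cases k <;> fin_cases l <;>
    simp [deltaOfPos, t12Delta, t12Q, sqDist] <;> ring_nf

/-- **Two branch systems ⟹ finitely many positive `T12` central configurations.** If the branch systems
`σ = (1,1,1,1)` and `σ = (1,1,1,−1)` of `T12Slice b c` have finitely many real solutions, then the masses
`(1,1,b,b,c)` admit only finitely many positive normalized central configurations (Definition 1 of
[AlbouyKaloshin2012]) in the `T12` normal form. [cite: AlbouyKaloshin2012, Definition 1 p. 536; Definition 2 / system (4) p. 540 — derived in-tree] -/
theorem t12PositiveCCs_finite_of_two (b c : ℝ) (hA : (t12BranchSet 1 1 1 1 b c).Finite)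
    (hB : (t12BranchSet 1 1 1 (-1) b c).Finite) : (t12PositiveCCs b c).Finite := by
  refine ((t12PosSet_finite_of_two b c hA hB).image
    (fun X : T12Pt => t12Q X.s X.t X.y₃ X.y₄ X.y₅)).subset ?_
  rintro q ⟨hq, s, t, y₃, y₄, y₅, rfl⟩
  have hreal := isRealNormalizedCC_of_isPositiveNormalizedCC hq
  rw [deltaOfPos_t12Q] at hreal
  have hsl := (isRealNormalizedCC_t12_iff b c s t y₃ y₄ y₅ _ _ _ _ _ _ _).1 hreal
  have hd := hq.1
  set q := t12Q s t y₃ y₄ y₅ with hqdef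
  refine ⟨⟨s, t, y₃, y₄, y₅, deltaOfPos q 0 1, deltaOfPos q 0 2, deltaOfPos q 0 3, deltaOfPos q 0 4,
    deltaOfPos q 2 3, deltaOfPos q 2 4, deltaOfPos q 3 4⟩, ⟨hsl, ?_, ?_, ?_, ?_⟩, rfl⟩
  · exact deltaOfPos_pos hd (show (0 : Fin 5) ≠ 1 by decide)
  · exact deltaOfPos_pos hd (show (2 : Fin 5) ≠ 3 by decide)
  · exact deltaOfPos_pos hd (show (2 : Fin 5) ≠ 4 by decide)
  · exact deltaOfPos_pos hd (show (3 : Fin 5) ≠ 4 by decide)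

end Literature.Dynamics.NBody
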